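import Summits.QuantumFields.QCD.Theorems.QuarksAsStableActionCriticalLineDiamagnetismRectFreqOpTranspose
import Summits.QuantumFields.QCD.Theorems.QuarksAsStableActionCriticalLineDiamagnetismRectFreqOpStatic
import Summits.QuantumFields.QCD.Theorems.QuarksAsStableActionWilsonQuarkStabilityStubStaticIterate

/-!
# Route B helper `rectDiamagnetism` for stub `stub_heavyFrequencyGain` of line `Sketch` — per-frequency diamagnetism of
the 2D frequency determinant on RECTANGULAR odd × odd two-tori `ℤ/L₁ × ℤ/L₂`
(crux `Summit.QuantumFields.QCD.Theses.QuarksAsStableAction.CriticalLineDiamagnetism`, item stmt-QuantumFields-9734,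
static route for odd tori, Route B of the heavy-frequency gain)

The rectangular twin of `stub_frequencyDiamagnetism`: for `L₁, L₂` odd, every field `A : ℤ/L₁ → ℤ/L₂ → Fin 4 → U(3)`,
every `m > −1` and every real frequency pair, `‖det D_{L₁×L₂}[A]‖ ≤ ‖det D_{L₁×L₂}[1]‖` (`D = freqOpR euclideanGamma`) —
the static pressure comparisons of Route B at all time lengths `L₁`.

Proof (the pipeline of `stub_frequencyDiamagnetism` with the rectangular ingredients):
* the static slice bound along the first coordinate (`rectStaticSliceBound`, odd `L₁`):
  `‖det D[A]‖^{L₁} ≤ ∏_{s : ℤ/L₁} ‖det D[S_s A]‖`, `S_s A` = links `A(s,·,3)` on every row, trivial links along the first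
  coordinate;
* the reflection covariance `det D_{L₁×L₂}[B] = det D_{L₂×L₁}[Bᵀ]`, `Bᵀ b a μ = B a b ((2 3) μ)` (`rectDetTranspose`), applied
  to `B = S_s A` and to the trivial field; the static slice bound along the (new) first coordinate (odd `L₂`) for `(S_s A)ᵀ`,
  whose static slices have ALL links along the two coordinates trivial, so that their frequency operator IS the free one
  (`freqOpR_congr_links`: `D` only reads the links along the two coordinates);
* the `L₁`-th and `L₂`-th roots, level by level (`staticIterate_root`).
-/

noncomputable section

open scoped BigOperators Matrix ComplexConjugate
open Finset
open Literature.MathematicalPhysics.QuantumLattice Literature.MathematicalPhysics.QuantumFieldTheory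
  Literature.Probability.LatticeModels

namespace Summit.QuantumFields.QCD.Cruxes.CriticalLineDiamagnetism.ChessboardCellGain

open Summit.QuantumFields.QCD.Cruxes.WilsonQuarkStability.FreeTangentLandauChessboard
open Summit.QuantumFields.QCD.Cruxes.CriticalLineDiamagnetism.ChessboardCellGain.FrequencyDiamagnetism

/-- **Route B helper `rectDiamagnetism`** (per-frequency diamagnetic inequality on rectangular odd × odd two-tori): for
`L₁, L₂` odd, every 2D `U(3)` field `A : ℤ/L₁ → ℤ/L₂ → Fin 4 → U(3)`, every `m > −1` and every real frequency pair, the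
rectangular 2D frequency determinant is dominated by the free one, `‖det D[A]‖ ≤ ‖det D[1]‖` — the static slice bound along
the first coordinate (`rectStaticSliceBound`, odd `L₁`), the reflection covariance `rectDetTranspose` and the static slice
bound along the second coordinate (odd `L₂`), after which every link read by `D` is trivial (`freqOpR_congr_links`); then the
roots (`staticIterate_root`). -/
theorem rectDiamagnetism : ∀ (L₁ L₂ : ℕ) [NeZero L₁] [NeZero L₂], Odd L₁ → Odd L₂ → ∀ (A : ZMod L₁ → ZMod L₂ → Fin 4 → Matrix.unitaryGroup (Fin 3) ℂ) (m : ℝ), -1 < m → ∀ ω₀ ω₁ : ℝ, ‖(freqOpR euclideanGamma A m ω₀ ω₁).det‖ ≤ ‖(freqOpR euclideanGamma (fun (_ : ZMod L₁) (_ : ZMod L₂) (_ : Fin 4) => (1 : Matrix.unitaryGroup (Fin 3) ℂ)) m ω₀ ω₁).det‖ := by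
  intro L₁ L₂ _ _ hL₁ hL₂ A m hm ω₀ ω₁
  -- a field on `ℤ/L₂ × ℤ/L₁` with trivial links along the two coordinates has the free determinant of `ℤ/L₁ × ℤ/L₂`
  have key : ∀ B : ZMod L₂ → ZMod L₁ → Fin 4 → Matrix.unitaryGroup (Fin 3) ℂ,
      (∀ t x, B t x 2 = 1) → (∀ t x, B t x 3 = 1) →
      ‖(freqOpR euclideanGamma B m ω₀ ω₁).det‖ =
        ‖(freqOpR euclideanGamma (fun (_ : ZMod L₁) (_ : ZMod L₂) (_ : Fin 4) =>
          (1 : Matrix.unitaryGroup (Fin 3) ℂ)) m ω₀ ω₁).det‖ := fun B h2 h3 => by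
    rw [rectDetTranspose L₁ L₂ (fun (_ : ZMod L₁) (_ : ZMod L₂) (_ : Fin 4) => (1 : Matrix.unitaryGroup (Fin 3) ℂ))]
    exact congrArg
      (fun M : Matrix ((ZMod L₂ × ZMod L₁) × Fin 3 × Fin 4) ((ZMod L₂ × ZMod L₁) × Fin 3 × Fin 4) ℂ => ‖M.det‖)
      (freqOpR_congr_links (fun (_ : ZMod L₂) (_ : ZMod L₁) (_ : Fin 4) => (1 : Matrix.unitaryGroup (Fin 3) ℂ))
        m ω₀ ω₁ euclideanGamma B (fun t x => h2 t x) (fun t x => h3 t x))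
  -- static along the first coordinate (odd `L₁`), root
  refine staticIterate_root (norm_nonneg _) (rectStaticSliceBound L₁ L₂ hL₁ A m hm ω₀ ω₁) (fun _ => norm_nonneg _)
    fun s => ?_
  -- reflect the static field to `ℤ/L₂ × ℤ/L₁`, static along its first coordinate (odd `L₂`), root: every link is trivial
  rw [rectDetTranspose L₁ L₂ (fun (_ : ZMod L₁) (x : ZMod L₂) (μ : Fin 4) => if μ = 3 then A s x 3 else 1)]
  refine staticIterate_root (norm_nonneg _) (rectStaticSliceBound L₂ L₁ hL₂ _ m hm ω₀ ω₁) (fun _ => norm_nonneg _)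
    fun s' => le_of_eq (key _ (fun t x => ?_) (fun t x => ?_))
  · simp
  · simp

end Summit.QuantumFields.QCD.Cruxes.CriticalLineDiamagnetism.ChessboardCellGain

end
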